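import Summits.FinalStateConjecture.FinalStateConjecture.Theorems.ChannelsResolveTameDevelopmentsR.Negative.SubMinkowskiSettledT2
import Summits.FinalStateConjecture.FinalStateConjecture.Theorems.PhotonSphereChannelsEndVisibleDefs
import Summits.FinalStateConjecture.FinalStateConjecture.Theorems.ChannelsResolveTameDevelopmentsR.Negative.SlabMinkowskiLoadBearing
import HarnessLib

/-!
# The end-visibility adapter and stub B of line `Sketch` on the flat model class — support for the crux
# `ChannelsResolveTameDevelopmentsR` (K2R-T2, item `stmt-FinalStateConjecture-17430`, route PhotonSphereChannels)

Line `Sketch` (lead prover-line-stmt-FinalStateConjecture-17430-0) splits the crux as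
`NoHidden ∧ K2REnd ⇒ crux` along end-visibility (`Theorems/PhotonSphereChannelsEndVisibleDefs.lean`).
This file checks, on the certifiable model class — the open sub-developments `η|_U` of the trivial datum
with `{x⁰ ≥ 0} ⊆ U` (equivalently complete `𝓘⁺`, `hasCompleteNullInfinity_iff_future_subset`) — that

* the one obligation an honest radiation-zone chart must discharge to get C_end for free,
  `FarRaysShadowedBy 𝒟 d.charted` ("the flat chart swallows late `𝓘⁺`"), IS discharged by the honest
  `N = 0` decomposition `subDecomp` (`farRaysShadowedBy_charted_subDecomp`: a ray point `δ t`, `t ≥ 0`, has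
  time coordinate `t ≥ 0`, hence lies in `I⁻({x⁰ > 1}) = I⁻(charted)`), with exempted compact set `K = ∅`;
* stub B's conclusion `EndVisible.SettlesEndVisibly` holds there (`settlesEndVisibly_subDev`,
  `settlesEndVisibly_of_hasCompleteNullInfinity`) — "stub B without `IsMaximal`" is TRUE on every model the
  tree can certify, exactly like Φ″ (`settlesT2_of_hasCompleteNullInfinity`).

All results proved; no named facts.
-/

noncomputable section

open Bundle Set Function Filter TopologicalSpace Topology
open scoped Manifold ContDiff Topology ENNReal

set_option linter.dupNamespace false

namespace Summit.FinalStateConjecture.FinalStateConjecture.Theorems.ChannelsResolveTameDevelopmentsR.SubMinkowski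

open Literature.Geometry.Lorentzian Literature.Geometry.Lorentzian.Minkowski
open Summit.FinalStateConjecture.FinalStateConjecture.Theorems

section Adapter

variable {U : Opens E4} {hU : IsConnected (U : Set E4)} {hsl : ∀ y : slice, sliceEmbed y ∈ U}
  {hC : (subMetric U).IsCauchyHypersurface (subOrientation U)
    (range (vacuumCauchyDevelopment.embedOpens U hsl))}

/-- **Time coordinate along a normalised ray of `η|_U`**: `(γ t)⁰ = t` on the affine domain — the ray is
straight (`geodesic_affine`), starts on the slice `{x⁰ = 0}` and is normalised by `η(γ'(0), ∂ₜ) = −1`, i.e.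
`v⁰ = 1`. (The computation inside `raysStayInClosure_futureSet`, isolated.) [cite: ONeill1983, Ch. 3, Cor. 21] -/
theorem ray_time_eq [hLC : (subDev U hU hsl hC).metric.HasLeviCivita] {y : slice}
    {γ : ℝ → U} {dom : Set ℝ}
    (hray : (subDev U hU hsl hC).metric.IsNormalisedNullRayFrom (subDev U hU hsl hC).timeOrientation
      (subDev U hU hsl hC).embed (subDev U hU hsl hC).normal y γ dom) {t : ℝ} (ht : t ∈ dom) :
    ((γ t : U) : E4) 0 = t := by
  haveI : (subMetric U).toPseudoRiemannianMetric.HasLeviCivita := hLC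
  obtain ⟨hmax, h0, hγ0, -, -, hnorm⟩ := hray
  change IsMaximalGeodesicOn (subMetric U).toPseudoRiemannianMetric.leviCivita γ dom at hmax
  obtain ⟨v, hv, -, hline⟩ := geodesic_affine hmax.isGeodesicOn hmax.isOpen hmax.2.1 h0
  have hv0 : v 0 = 1 := by
    have h' : bilin (velocity 𝓘(ℝ, E4) γ 0) (E4.basisVector 0) = -1 := hnorm
    rw [hv, bilin_symm, bilin_basisVector_zero_left] at h'
    linarith
  show ((γ t : U) : E4) 0 = t
  rw [hline t ht]
  have h00 : (γ 0 : E4) 0 = 0 := by rw [hγ0]; rfl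
  have : ((γ 0 : E4) + t • v) 0 = (γ 0 : E4) 0 + t * v 0 := by simp
  rw [this, h00, hv0]
  ring

/-- **The honest flat chart shadows ALL complete rays** (`K = ∅`): if `{x⁰ ≥ 0} ⊆ U`, the chronological
past of the nonnegative half of every normalised future null ray of `η|_U` from the slice lies in
`I⁻(charted) = I⁻({x⁰ > 1})` — a ray point `δ t`, `t ≥ 0`, has time `t ≥ 0` and is itself in
`I⁻({x⁰ > 1})` (`mem_chronologicalPast_late_of_time_nonneg`), and `≪` is transitive. This is the adapter
obligation `FarRaysShadowedBy` of line `Sketch`, met by `subDecomp`. [cite: DafermosLuk2017, Conjecture 1] -/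
theorem farRaysShadowedBy_charted_subDecomp [(subDev U hU hsl hC).metric.HasLeviCivita]
    (hfut : {x : E4 | 0 ≤ x 0} ⊆ (U : Set E4)) :
    EndVisible.FarRaysShadowedBy (subDev U hU hsl hC).toCauchyDevelopment
      (subDecomp (hU := hU) (hsl := hsl) (hC := hC) hfut).charted := by
  refine ⟨∅, isCompact_empty, fun y _ δ s hδ _ q hq ↦ ?_⟩
  rw [charted_subDecomp]
  change ℝ → U at δ
  obtain ⟨x, ⟨t, ⟨ht, ht0⟩, rfl⟩, hqx⟩ :=
    (LorentzianMetric.mem_chronologicalPast_iff_exists (g := (subDev U hU hsl hC).metric)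
      (τ := (subDev U hU hsl hC).timeOrientation)).1 hq
  have htime : 0 ≤ ((δ t : U) : E4) 0 := by rw [ray_time_eq hδ ht]; exact ht0
  have hlate : δ t ∈ (subMetric U).chronologicalPast (subOrientation U) {z : U | 1 < (z : E4) 0} :=
    mem_chronologicalPast_late_of_time_nonneg hfut htime 1
  exact LorentzianMetric.mem_chronologicalPast_trans hlate
    (LorentzianMetric.mem_chronologicalPast_of_mem_chronologicalFuture hqx)

/-- **Stub B's conclusion on the flat class**: if `{x⁰ ≥ 0} ⊆ U`, `η|_U` settles end-visibly
(`EndVisible.SettlesEndVisibly`: honest `O = exteriorOf`, C_end, exhaustive, future-oriented) — from the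
T2 model theorem `settlesT2_of_future_subset` by weakening (C) to C_end. [cite: ChristodoulouKlainerman1993, Thm. 1.0.2] -/
theorem settlesEndVisibly_subDev (hfut : {x : E4 | 0 ≤ x 0} ⊆ (U : Set E4)) :
    EndVisible.SettlesEndVisibly (subDev U hU hsl hC) := by
  obtain ⟨O, d, -, hO, hC', hexh, hfo⟩ := settlesT2_of_future_subset (hU := hU) (hsl := hsl) (hC := hC) hfut
  exact EndVisible.settlesEndVisibly_of_settlesT2 ⟨O, d, hO, hC', hexh, hfo⟩

/-- **"Stub B without `IsMaximal`" HOLDS ON THE FLAT MODEL CLASS — from completeness alone**: every open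
sub-development `η|_U` of the trivial datum with complete `𝓘⁺` settles end-visibly. So the registered
`stub_k2REnd` of line `Sketch`, like Φ″, is true and non-vacuous on every model the tree can certify
(`exists_complete_settledT2_not_isMaximal` supplies a complete non-maximal one); its open content is
entirely off the flat class. [cite: Christodoulou1999, pp. A26–A27] -/
theorem settlesEndVisibly_of_hasCompleteNullInfinity
    (h : _root_.Summit.FinalStateConjecture.HasCompleteNullInfinity (subDev U hU hsl hC).toCauchyDevelopment) :
    EndVisible.SettlesEndVisibly (subDev U hU hsl hC) :=
  settlesEndVisibly_subDev (hasCompleteNullInfinity_iff_future_subset.1 h)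

end Adapter

/-- **Registered sub-goal `stub_flatModelSettlesEndVisibly` of line `Sketch`** (crux stmt-FinalStateConjecture-17430):
the model certificate of stub B — on the certifiable flat class, complete `𝓘⁺` alone gives
`EndVisible.SettlesEndVisibly` (`settlesEndVisibly_of_hasCompleteNullInfinity` under the registered name and
one-line signature). [cite: Christodoulou1999, pp. A26–A27] -/
theorem stub_flatModelSettlesEndVisibly : ∀ {U : Opens E4} {hU : IsConnected (U : Set E4)} {hsl : ∀ y : slice, sliceEmbed y ∈ U} {hC : (subMetric U).IsCauchyHypersurface (subOrientation U) (range (vacuumCauchyDevelopment.embedOpens U hsl))}, _root_.Summit.FinalStateConjecture.HasCompleteNullInfinity (subDev U hU hsl hC).toCauchyDevelopment → EndVisible.SettlesEndVisibly (subDev U hU hsl hC) :=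
  fun h ↦ settlesEndVisibly_of_hasCompleteNullInfinity h

/-! ### Appendix (append protocol, same seat): stub B's structural hypotheses are jointly load-bearing

Exactly as for Φ (`Negative.not_tameResolution_allDevelopments`): the time slab `{-1 < x⁰ < 1}` of
Minkowski space (`Negative.slab`), an admissible vacuum Cauchy development of the trivial datum satisfying
(i) and (ii), admits no final-state decomposition of any region in any `Cᵏ`
(`Negative.isEmpty_finalStateDecomposition_slab`), hence does not settle end-visibly; so the registered
`stub_k2REnd` of line `Sketch` with BOTH `IsMaximal` and complete `𝓘⁺` deleted is false, while with
`IsMaximal` alone deleted it is true on the flat class (`settlesEndVisibly_of_hasCompleteNullInfinity`). -/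

section LoadBearing

open Summit.FinalStateConjecture.FinalStateConjecture.Theorems.ChannelsResolveTameDevelopmentsR.Negative

/-- **The slab does not settle end-visibly** (no `FinalStateDecomposition` of any region of it exists).
[cite: ChristodoulouKlainerman1993, Thm. 1.0.2] -/
theorem not_settlesEndVisibly_slab : ¬ EndVisible.SettlesEndVisibly slab :=
  fun ⟨O, d, _⟩ ↦ (isEmpty_finalStateDecomposition_slab O 2).false d

/-- **Stub B with `IsMaximal` and complete `𝓘⁺` both deleted is FALSE** (witness `slab`: admissible,
(i) `slab_noExtremalChart`, (ii) `slab_tame`, not end-visibly settled). Hence the pair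
{`IsMaximal`, complete `𝓘⁺`} is load-bearing in `stub_k2REnd` exactly as in K2R ≡ Φ.
[cite: Ringstrom2009, Def. 16.5] -/
theorem stubB_false_without_maximal_and_complete :
    ¬ ∀ (X : Type) [TopologicalSpace X] [ChartedSpace E3 X] [IsManifold (𝓡 3) ∞ X] [T2Space X]
      [SecondCountableTopology X] [ConnectedSpace X],
      ∀ D ∈ admissibleVacuumData X, ∀ 𝒟 : VacuumCauchyDevelopment D,
        (TrappedSet.NoExtremalRemnant 𝒟 ∧ TrappedSet.TameOuterRegion 𝒟) → EndVisible.SettlesEndVisibly 𝒟 :=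
  fun h ↦ not_settlesEndVisibly_slab
    (h (↥Minkowski.slice) trivialData trivialData_mem_admissibleVacuumData slab ⟨slab_noExtremalChart, slab_tame⟩)

end LoadBearing

end Summit.FinalStateConjecture.FinalStateConjecture.Theorems.ChannelsResolveTameDevelopmentsR.SubMinkowski

end
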